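/-
Copyright: the b2b-balaban cell (near-miss cell 7), T⁴-continuum fan-out; row NE7b ROUND-2 swarm, seat
t4-ne7b-formalise-leaf-03 (row S12 «ASSEMBLY» of `t4/b2b-balaban-t4-ne7b-p1/LEAVES-NE7b.md`; node A12 of the typer's
`t4/formal/NE7b/DAG.md`).  Released under the licence of the surrounding project.
-/
import Summits.QuantumFields.BalabanUV.T4Continuum.Support.HistoryAssemblyTrees
import Summits.QuantumFields.BalabanUV.T4Continuum.Support.HistorySocketTH

/-!
# History assembly over the tree-slot SOCKET: `LiveHistoriesTH` at `D = 0`, `Δ = 1` into the plugged exit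

Summits-side support leaf of the T⁴-continuum cell (rung (B)+1 on a FINITE torus only; NOT infinite volume, NOT the
mass gap, NOT the Clay statement; NOT a proof of the spine estimate NE7b).  Row NE7b, route «COUNT», ROUND-2 swarm
row S12 §4 (ruling R-OWNER-22-1 R2: «leaf-10 files socket v3 `HistorySocketTH`, leaf-03 assembles on it»).  [folklore]
COMPOSITION BY NAME; nothing is quoted from print, nothing printed is asserted, no `[cite:]` tag, no `Prop`-valued fact
of Bałaban's is minted (trigger c1); the socket, H3's numerator readings, (B) and the BetaPertH-flow facts are DISPLAYED
(c4).

WHAT.  §1 `hlabT_of_liveTH₀`: the socket's derived labelled-price binder (`HistorySocketTH.hlabTH_of_live`) at horizon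
`D = 0`, `Δ = 1`, rewritten into the CLEAN form displayed by `HistoryAssemblyTrees.hybridNE7_of_treeBinders_canon`
(`ConsistentT` for `ConsistentTH … 0`, `K < reach` for `K − 0 < reach`, the true window table for `padW … 0`, no
factor `1`); the finiteness of the bad classes at a cutoff (`BadFin`) from the displayed `bad_subset`.  §2
**`hybridNE7_of_liveHistoriesTH_canon`**: the plugged tree-slot exit (S12 §3: typed flow along the tuned runs, cells
`cellN d n F.L`, matching scale `jhalf`, rates at `η̄₊ = log 2` from the two largeness conditions, both `Regeneration`
runs from the stability socket) with its four tree-slot (ID) binders REPLACED by ONE hypothesis — the socket of record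
`LiveHistoriesTH sh C (L^d) 1 l₀ K₀ R g (cellN d n F.L) Dcap Ncap jhalf 0 Bad′ Fc Rf Fc′ Rf′ live` over the TRUE
couplings of the tuned runs (the clamp at the cutoff is internal to the junction).

DISPLAYED after §2: constants (`ThresholdOK`, `0 < μ`, `κ₁ ≥ d·log L + 2 log 2`, `E₀ ≥ log (2 + birthMass C)`, `n`,
`Dcap`, `Ncap`), the flow side (⇐ BetaPertH), tuning, `irThresholdTH sh C F.L rr β₀ 0 ≤ log g⁻²`, the (2.5) side
condition, the (B) side (`SignConventions`, `Cor3With`, observable, (α), (γ), sites, envelopes), H3's five numerator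
fields per run over the socket's classes (`bad_subset`, `up`, `dead_nonneg`, `resum`, `F_nonneg`), THE SOCKET, NE7c's
`ShellWeightBound`, NE7's `ReindexedBudget`, four summable rates.  The term-keyed twin (classes DEFINED as bslot
families of terms, `bad_subset` proved) is `HistoryAssemblyTerms.hybridNE7_of_termReading_canon`.

HEADLINE (c4): «COUNT route, tree-slot form: exit + seam with every kernel-able binder plugged, over the socket
`LiveHistoriesTH`; H3 + (B) + BetaPertH-flow + NE7c socket + NE7 core budget displayed» — NOT «NE7b proved».  HONEST
DEPENDENCY (cell): continuum YM on T⁴ ⇐ BetaPertH ∧ nine spine estimates (0/9 proved); BetaPertH ⇐ (D1) ∧ (D4) ∧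
CAP+tail.  This file changes none of it.
-/

open Finset MeasureTheory
open Literature.MathematicalPhysics.QuantumFieldTheory.Balaban1983to89
open T4PersistenceDictionary T4PersistentHistoryCount T4BankedInduction T4PrintedShapeBanking
open T4WeightBudget T4GlobalDenominator T4LiveClassFibration T4LiveStructureGas T4LiveGasToTerms T4RecordPriceSeam
open T4PartnerMultiplicity T4IndicatorShell T4MatchingAssembly T4MatchingClosure T4MatchingClosureSocket T4Continuum
open T4StabilitySocket T4BranchingRecordsGas T4TaggedShapeBanking T4CanonicalMenus T4RenewalChains
open Summit.QuantumFields.BalabanUV.T4Continuum.PlacementBatch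
open Summit.QuantumFields.BalabanUV.T4Continuum.PlacementSkeleton
open Summit.QuantumFields.BalabanUV.T4Continuum.CountThresholdUniform
open Summit.QuantumFields.BalabanUV.T4Continuum.CountThresholdExit
open Summit.QuantumFields.BalabanUV.T4Continuum.CountSeamJunction
open Summit.QuantumFields.BalabanUV.T4Continuum.LateMergers
open Summit.QuantumFields.BalabanUV.T4Continuum.HistoryFlow
open Summit.QuantumFields.BalabanUV.T4Continuum.HistoryRegeneration
open Summit.QuantumFields.BalabanUV.T4Continuum.HistoryTables
open Summit.QuantumFields.BalabanUV.T4Continuum.HistoryAssemblyTrees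
open Summit.QuantumFields.BalabanUV.T4Continuum.HistorySocketTH

namespace Summit.QuantumFields.BalabanUV.T4Continuum.HistoryAssemblySocketTH

noncomputable section

/-! ## §1 The socket's labelled-price binder at `D = 0`, `Δ = 1`, in the clean form -/

section Clean

variable {ε γ κ : Type*} [DecidableEq ε] [DecidableEq γ] {sh : ε → PEv} {C : T4PrintedShapeBanking.Consts}
  {Λ' l₀ : ℝ} {K₀ : ℕ} {R : ℕ → ℕ → ℕ} {g : ℕ → ℕ → ℝ} {Cell : ℕ → ℕ → Finset γ} {Dcap Ncap : ℕ → ℕ}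
  {jstar : ℕ → ℕ} {Bad' : ℕ → ℝ → Finset κ} {F Rf F' Rf' : ℕ → κ → ℝ} {live : ℕ → κ → Finset (γ × Gen ε)}

/-- the displayed `bad_subset` (bad classes are live classes of actual terms) gives finitely many bad classes per cutoff
[folklore] -/
theorem badFin_of_bad_subset {ι : Type*} [DecidableEq κ] {π : ℕ → ι → κ} {T : ℕ → Finset ι}
    (bad_subset : ∀ K t, |t| ≤ l₀ → K₀ ≤ K → Bad' K t ⊆ classIndex π T K) {K : ℕ} (hK : K₀ ≤ K) :
    BadFin l₀ Bad' K :=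
  ⟨classIndex π T K, fun t ht => bad_subset K t ht hK⟩

/-- **THE SOCKET'S `hlabTH` AT `D = 0`, `Δ = 1`, CLEAN FORM**: at every counted slot the max-price is `≤ 0` or the
tree-slot price of a `ConsistentT`, fresh, pending (`K < reach` over the true table) member of that shape — the
arg-max occupant (`HistorySocketTH.hlabTH_of_live`, `LateMergers.consistentTH_zero_iff`, `padW W 0 = W`). [folklore] -/
theorem hlabT_of_liveTH₀ (H : LiveHistoriesTH sh C Λ' 1 l₀ K₀ R g Cell Dcap Ncap jstar 0 Bad' F Rf F' Rf' live)
    (hfin : ∀ K, K₀ ≤ K → BadFin l₀ Bad' K) (K : ℕ) (hK : K₀ ≤ K) (j : ℕ) (hj : j ≤ K) (z : γ)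
    (hz : z ∈ Cell K (K - j)) (Gs : Gen PEv) (hG : Gs ∈ canonFam Dcap Ncap K j) :
    yTH sh C Λ' 1 l₀ R g 0 Bad' live K j z Gs ≤ 0 ∨ ∃ G' : Gen ε, ConsistentT sh C K (R K) G' ∧ FreshT G' ∧
      K < G'.reach (dictWT sh (R K) C.n₁) ∧ relabel (shape ∘ sh) G' = Gs ∧
      yTH sh C Λ' 1 l₀ R g 0 Bad' live K j z Gs ≤ Λ' ^ partnerAges (PEv.step ∘ sh) G' *
        (Real.exp (-credits (credit C (g K) ∘ sh) G') *
          Real.exp (lifeCost (dictWT sh (R K) C.n₁) (costT sh C K (R K)) G')) := by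
  rcases hlabTH_of_live H hfin K hK j hj z hz Gs hG with h0 | ⟨G', hc, hf, hr, hrel, hy⟩
  · exact Or.inl h0
  · refine Or.inr ⟨G', consistentTH_zero_iff.1 hc, hf, by simpa using hr, hrel, ?_⟩
    rw [one_mul, padW_zero] at hy
    exact hy

end Clean

/-! ## §2 The plugged exit over the socket -/

section End

variable {F : T4Family} {G : Type*} [GaugeGroup G] [MeasurableSpace G] [HaarData G] [RegularGaugeGroup G]
variable {ε : Type*} [DecidableEq ε]
variable {ι κc : Type*} [DecidableEq κc] [DecidableEq ι] {l₀ vol : ℝ} {K₀ : ℕ} {π : ℕ → ι → κc}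
  {T : ℕ → Finset ι} {A A' shA shB : ℕ → ℝ → ι → ℝ} {Bad' : ℕ → ℝ → Finset κc} {dead dead' : ℕ → ℝ → ι → ℝ}
  {Fc Rf Fc' Rf' : ℕ → κc → ℝ} {nup mup : ℕ → ℝ → ℝ} {Nup : ℝ}
  {Cc Rr CcRec RrRec : ℕ → ℝ → ι → ℝ} {ν u s₂ q₀ r s Wsh : ℕ → ℝ}

/-- **NE7b's COUNT EXIT OVER THE TREE-SLOT SOCKET, EVERYTHING KERNEL-ABLE PLUGGED.**
`HistoryAssemblyTrees.hybridNE7_of_treeBinders_canon` (TH exit at `D = 0`, `Δ = 1` along the tuned runs; typed flow,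
cells, matching scale, rates and both `Regeneration` runs plugged) with its four tree-slot (ID) binders REPLACED by the
socket of record `HistorySocketTH.LiveHistoriesTH sh C (L^d) 1 l₀ K₀ R g (cellN d n F.L) Dcap Ncap jhalf 0 Bad′ …
live` over the TRUE couplings `g K := (D.C ⟨K, F.m, g₀ K⟩).flow.g` — via `yTH`∕`yTH_nonneg`∕`hlabT_of_liveTH₀`∕
`bstrOf`∕`hinj_of_live`∕`hstr_of_live`∕`hF_of_live`, the finiteness behind the max-price from the displayed
`bad_subset`.  Displayed: constants + two largeness conditions, flow side, tuning, `irThresholdTH sh C F.L rr β₀ 0 ≤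
log g⁻²`, (2.5) side condition, (B) side, H3's numerator readings, the socket, the seam data. [folklore] -/
theorem hybridNE7_of_liveHistoriesTH_canon (D : FiniteEpsData F G) (sh : ε → PEv) {C : T4PrintedShapeBanking.Consts}
    {rr : ℕ} {β₀ : ℝ} (h : ThresholdOK C F.L rr β₀) (hμ : 0 < C.μ) (d n : ℕ) (Dcap Ncap : ℕ → ℕ)
    (hκ₁ : (d : ℝ) * Real.log F.L + 2 * Real.log 2 ≤ C.κ₁) (hE₀ : Real.log (2 + birthMass C) ≤ C.E₀)
    -- the flow side (⇐ BetaPertH, displayed) and tuning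
    {γ₀ γb b β' : ℝ} {pe : ℕ} (hb : 0 ≤ b) (hlo : FlowStep.BetaLowerH b γ₀ D.βfun)
    (hhi : FlowStep.BetaUpperH β' γ₀ D.βfun) (hγ : γb ≤ γ₀) (hγβ : γb ^ 2 * β' < 1)
    (S : B14FlowStep.SmallnessFor γb β' β₀ F.L pe) (hp₀ : C.p₀ ≤ pe) (hrr : rr ≤ pe)
    {g : ℝ} {g₀ : ℕ → ℝ} (ht : D.Tuned γb g g₀)
    (hir : irThresholdTH sh C F.L rr β₀ 0 ≤ Real.log (g ^ 2)⁻¹)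
    -- the (B) side
    (hsign : B16.SignConventions D.C) {γB : ℝ} {em ep : ℝ → ℝ} (hcor : B16.Cor3With D.C γB em ep) (hγB : γb ≤ γB)
    {obs : (K : ℕ) → GaugeField (F.P K) 0 G → ℝ} {B : ℝ}
    (hobs : ∀ K, Measurable (obs K)) (hbd : ∀ K U, |obs K U| ≤ B)
    (hα : ∀ K t, |t| ≤ l₀ → K₀ ≤ K →
      ∫ U, Real.exp (t * obs K U) * D.dens K (g₀ K) 0 U ∂fieldMeasure (F.P K) 0 G ≤ ∑ τ ∈ T K, A K t τ)
    (hα' : ∀ K t, |t| ≤ l₀ → K₀ ≤ K →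
      ∫ U, Real.exp (t * obs (K + 1) U) * D.dens (K + 1) (g₀ (K + 1)) 0 U ∂fieldMeasure (F.P (K + 1)) 0 G ≤
        ∑ τ ∈ T K, A' K t τ)
    {c₀ n₁ : ℝ} (hc₀ : 0 < c₀) (hfloor : ∀ K, K₀ ≤ K → c₀ ≤ smallFieldMass D K (g₀ K))
    (hfloor' : ∀ K, K₀ ≤ K → c₀ ≤ smallFieldMass D (K + 1) (g₀ (K + 1)))
    (hsites : ∀ K, K₀ ≤ K → ((D.C ⟨K, F.m, g₀ K⟩).numSites K : ℝ) ≤ n₁)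
    (hsites' : ∀ K, K₀ ≤ K → ((D.C ⟨K + 1, F.m, g₀ (K + 1)⟩).numSites (K + 1) : ℝ) ≤ n₁)
    (hNup : 0 ≤ Nup) (hnup : ∀ K t, |t| ≤ l₀ → K₀ ≤ K → 0 ≤ nup K t ∧ nup K t ≤ Nup)
    (hmup : ∀ K t, |t| ≤ l₀ → K₀ ≤ K → 0 ≤ mup K t ∧ mup K t ≤ Nup)
    -- H3: the displayed numerator reading of both runs over the socket's classes
    (bad_subset : ∀ K t, |t| ≤ l₀ → K₀ ≤ K → Bad' K t ⊆ classIndex π T K)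
    (up : ∀ K t, |t| ≤ l₀ → K₀ ≤ K → ∀ c ∈ Bad' K t, ∀ τ ∈ fibre π T K c, A K t τ ≤ dead K t τ * Fc K c * nup K t)
    (dead_nonneg : ∀ K t, |t| ≤ l₀ → K₀ ≤ K → ∀ c ∈ Bad' K t, ∀ τ ∈ fibre π T K c, 0 ≤ dead K t τ)
    (resum : ∀ K t, |t| ≤ l₀ → K₀ ≤ K → ∀ c ∈ Bad' K t, ∑ τ ∈ fibre π T K c, dead K t τ ≤ Rf K c)
    (F_nonneg : ∀ K t, |t| ≤ l₀ → K₀ ≤ K → ∀ c ∈ Bad' K t, 0 ≤ Fc K c)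
    (up' : ∀ K t, |t| ≤ l₀ → K₀ ≤ K → ∀ c ∈ Bad' K t, ∀ τ ∈ fibre π T K c,
      A' K t τ ≤ dead' K t τ * Fc' K c * mup K t)
    (dead'_nonneg : ∀ K t, |t| ≤ l₀ → K₀ ≤ K → ∀ c ∈ Bad' K t, ∀ τ ∈ fibre π T K c, 0 ≤ dead' K t τ)
    (resum' : ∀ K t, |t| ≤ l₀ → K₀ ≤ K → ∀ c ∈ Bad' K t, ∑ τ ∈ fibre π T K c, dead' K t τ ≤ Rf' K c)
    (F'_nonneg : ∀ K t, |t| ≤ l₀ → K₀ ≤ K → ∀ c ∈ Bad' K t, 0 ≤ Fc' K c)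
    -- the (2.5) side condition on the size function the socket is built over
    (R : ℕ → ℕ → ℕ) (hR : ∀ K s, s ≤ K → B14.IsRj F.L rr ((D.C ⟨K, F.m, g₀ K⟩).flow.g s) (R K s))
    -- THE SOCKET at `D = 0`, `Δ = 1`, `Λ′ = L^d`, over the canonical cells, matching scale `jhalf`, the true couplings
    {live : ℕ → κc → Finset ((Fin d → ℕ) × Gen ε)}
    (H : LiveHistoriesTH sh C ((F.L : ℝ) ^ d) 1 l₀ K₀ R (fun K => (D.C ⟨K, F.m, g₀ K⟩).flow.g) (cellN d n F.L)
      Dcap Ncap jhalf 0 Bad' Fc Rf Fc' Rf' live)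
    -- the seam's other inputs
    (hSh : ShellWeightBound l₀ T A A' shA shB Wsh)
    (hTB : ReindexedBudget l₀ vol T (fun K t τ => A K t τ - shA K t τ) (fun K t τ => A' K t τ - shB K t τ)
      (badOfClass π T Bad') Cc Rr CcRec RrRec ν u s₂ q₀ r s)
    (hr : Summable r) (hu : Summable u) (hs : Summable s) (hs₂ : Summable s₂) :
    ∃ K₁ K₂, K₀ ≤ K₁ ∧ HybridNE7 l₀ vol (fun K => T (K₁ + (K₂ + K))) (fun K => A (K₁ + (K₂ + K)))
      (fun K => A' (K₁ + (K₂ + K))) (fun K => badOfClass π T Bad' (K₁ + (K₂ + K)))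
      (fun K => constOf l₀ B (max (em g) 0) n₁ c₀ Nup *
        recordsBudget (birthMass C) C.κ₁ ((n : ℝ) ^ d) ((F.L : ℝ) ^ d) (Real.log 2) jhalf (K₁ + (K₂ + K)))
      (fun K => shA (K₁ + (K₂ + K))) (fun K => shB (K₁ + (K₂ + K))) (fun K => Wsh (K₁ + (K₂ + K)))
      (fun K => (r (K₁ + (K₂ + K)) + u (K₁ + (K₂ + K))) + (s (K₁ + (K₂ + K)) + s₂ (K₁ + (K₂ + K)))) := by
  have hLpos : (0 : ℝ) < F.L := by exact_mod_cast (lt_of_lt_of_le (by norm_num) (two_le_L F))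
  have hΛ : (0 : ℝ) ≤ (F.L : ℝ) ^ d := pow_nonneg hLpos.le d
  have hfin : ∀ K, K₀ ≤ K → BadFin l₀ Bad' K := fun K hK => badFin_of_bad_subset bad_subset hK
  exact hybridNE7_of_treeBinders_canon D sh h hμ d n Dcap Ncap hκ₁ hE₀ hb hlo hhi hγ hγβ S hp₀ hrr ht hir hsign hcor
    hγB hobs hbd hα hα' hc₀ hfloor hfloor' hsites hsites' hNup hnup hmup bad_subset up dead_nonneg resum F_nonneg up'
    dead'_nonneg resum' F'_nonneg R hR
    (yTH sh C ((F.L : ℝ) ^ d) 1 l₀ R (fun K => (D.C ⟨K, F.m, g₀ K⟩).flow.g) 0 Bad' live)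
    (fun K j _ z _ Gs _ => yTH_nonneg K j z Gs)
    (fun K hK j hj z hz Gs hGs => hlabT_of_liveTH₀ H hfin K hK j hj z hz Gs hGs)
    (bstrOf sh live) (hinj_of_live H) (fun K t ht hK c hc => hstr_of_live H K t ht hK c hc)
    (fun K t ht hK => hF_of_live zero_le_one hΛ H (hfin K hK) t ht hK)
    (fun K t ht hK => hF'_of_live zero_le_one hΛ H (hfin K hK) t ht hK) hSh hTB hr hu hs hs₂

end End

end

end Summit.QuantumFields.BalabanUV.T4Continuum.HistoryAssemblySocketTH
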